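import Summits.BirchSwinnertonDyer.BirchSwinnertonDyer.Theorems.ManinLocalTwoThreeGenerationOfRelativeIhara
import Summits.BirchSwinnertonDyer.BirchSwinnertonDyer.Theorems.ManinLocalTwoThreeGenerationOfRelativeIharaTwo
import Summits.BirchSwinnertonDyer.Rank1Residual.ManinAdditive.RelativeIharaShiftVanishing
import Literature.NumberTheory.EllipticCurves.ModPIrreducibleNotEisensteinForms
import Summits.BirchSwinnertonDyer.BirchSwinnertonDyer.Theorems.ManinLocalTwoThreeGenerationHeckeCharacterLever
import Summits.BirchSwinnertonDyer.Rank1Residual.ManinAdditive.RelativeIharaCokernelOfCurve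
import HarnessLib

/-!
# Route `ManinLocalTwoThree`, crux C3 (stmt-BirchSwinnertonDyer-22968): E-es-19 `ShiftClassGenerationThree` from the TWO
# NAMED inputs — the cell's `@[conjecture]` leaf E-es-25 `RelativeIharaShiftVanishingBar 3 3 1` (typer p596841) and the
# Literature fact `not_isEisensteinEigensystem_of_hasIrreducibleModPGaloisRep` (typer p596515, Darmon–Diamond–Taylor 1995);
# and the C2 twin (stmt-BirchSwinnertonDyer-22967): E-es-22 `MultiShiftClassGenerationTwo` from the leaf at `(2,2,3)`, `(2,t,1)`
# and p3's residual hypothesis `hRes` (at `p = 2` NOT vacuous: the `C₃`-image classes, es's row E-es-22[C₃]);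
# and the HOMOLOGICAL currency: E-es-18 `KatoShiftTwistManinThree` from p3's lever with the named leaf E-es-25ᴴ
# `RelativeIharaCokernelOfCurve 3 3 1` (typer p597917) in place of the inlined body

Typer g5 hand-over for the line provers (Theorems/ is prover-only for the typer seat): composition of p3's
`shiftClassGenerationThree_of_relativeIharaBar (hRI) (hRes)` (p596337) with (i) the guarded leaf (instantiate the guards
`Nat.prime_three Nat.prime_three le_rfl`) and (ii) the fact, which makes the residual hypothesis `hRes` VACUOUS: for `W[3]`
irreducible the system `ℓ ↦ a_ℓ(W) mod 3` is never `IsEisensteinEigensystem 2` over `𝔽̄₃` (odd `p`: irreducible ⟹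
absolutely irreducible, Darmon–Diamond–Taylor p. 87; an image inside the non-split Cartan `C_ns(3)` is impossible over `ℚ`
because complex conjugation has `det = ε(c) = −1` and order `2`, while the only involution of `C_ns(3) ≅ 𝔽₉^×` is `−I`).
Nothing about BSD or Manin's conjecture is proved here; E-es-19 is proved modulo the conjecture leaf E-es-25(3,3,1) only.
-/

set_option autoImplicit false
set_option linter.dupNamespace false

noncomputable section

open scoped MatrixGroups ModularForm BigOperators

open CongruenceSubgroup WeierstrassCurve Literature.NumberTheory.EllipticCurves Literature.NumberTheory.EllipticCurves.ModularForms
  Summit.BirchSwinnertonDyer.Rank1Residual.ManinAdditive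

namespace Summit.BirchSwinnertonDyer.BirchSwinnertonDyer.Theorems.ManinLocalTwoThree

/-- **E-es-19 ⟸ E-es-25(3,3,1) (named leaf), unconditionally in the curve-side input.** The residual branch of
`shiftClassGenerationThree_of_relativeIharaBar` is empty by the Literature fact
`not_isEisensteinEigensystem_of_hasIrreducibleModPGaloisRep` (read in the `algebraMap (ZMod 3) 𝔽̄₃` shape,
`not_isEisensteinEigensystem_algebraMap_of_hasIrreducibleModPGaloisRep`). [folklore] -/
theorem shiftClassGenerationThree_of_relativeIharaShiftVanishingBar
    (hRI : RelativeIharaShiftVanishingBar 3 3 1)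
    (hF : not_isEisensteinEigensystem_of_hasIrreducibleModPGaloisRep) :
    ShiftClassGenerationThree :=
  haveI : Fact (Nat.Prime 3) := ⟨Nat.prime_three⟩
  shiftClassGenerationThree_of_relativeIharaBar
    (fun K _ _ L _ _ S lam u => hRI Nat.prime_three Nat.prime_three le_rfl K L S lam u)
    (fun W _ _ _ _ _ _ hirr hE _ _ =>
      absurd hE (not_isEisensteinEigensystem_algebraMap_of_hasIrreducibleModPGaloisRep hF W 3 (by decide) hirr (ZMod 3)))

/-- **E-es-22 ⟸ E-es-25(2,2,3) ∧ E-es-25(2,t,1) (t odd prime) — named leaf — ∧ the `C₃`-image residual.** p3's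
`multiShiftClassGenerationTwo_of_relativeIharaBar` (p596458) with `hRI8`, `hRIq` supplied BY NAME from the guarded leaf
`RelativeIharaShiftVanishingBar 2 t n`; the residual `hRes` (curves with `W[2]` irreducible whose system `a_ℓ mod 2` IS
Eisenstein over `𝔽̄₂` = the `C₃`-image classes, 3 950 of 897 670 in the cell census) stays a hypothesis — no Literature
fact removes it (es MEMO-es §22.8, row E-es-22[C₃]). [folklore] -/
theorem multiShiftClassGenerationTwo_of_relativeIharaShiftVanishingBar
    (hRI : ∀ t n : ℕ, RelativeIharaShiftVanishingBar 2 t n)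
    (hRes : ∀ (W : WeierstrassCurve ℚ) [W.IsElliptic] {N : ℕ} [NeZero N] (f : CuspForm (Gamma0 N) 2),
      IsNewformOf W f → 2 ^ 2 ∣ N → W.HasIrreducibleModPGaloisRep 2 →
      IsEisensteinEigensystem 2
        (fun ℓ : ℕ => algebraMap (ZMod 2) (AlgebraicClosure (ZMod 2)) ((W.LFunction ℓ : ℤ) : ZMod 2)) →
      ∀ φ : ↥(periodLattice f) →+ ZMod 2,
        (∀ x : ↥(periodLattice f), (x : ℂ) ∈
            periodLattice (∑ T ∈ (insert 8 (N.primeFactors.filter fun q => ¬ q ^ 2 ∣ N)).powerset,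
              (-1 : ℂ) ^ T.card • degeneracyMap0 N (8 * N ^ 2) (∏ t ∈ T, t - 1 + 1) 2 f) → φ x = 0) →
        φ = 0) :
    MultiShiftClassGenerationTwo :=
  multiShiftClassGenerationTwo_of_relativeIharaBar
    (fun K _ _ L _ _ S lam u => hRI 2 3 Nat.prime_two Nat.prime_two (by norm_num) K L S lam u)
    (fun t ht _ K _ _ L _ _ S lam u => hRI t 1 Nat.prime_two ht le_rfl K L S lam u)
    hRes

/-- **E-es-18 ⟸ (ES-step with a hole at `⟨3⟩`) ∧ E-es-25ᴴ(3,3,1) — named leaf.** p3's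
`katoShiftTwistManinThree_of_shiftStep_of_relativeIharaCokernelOfCurve (hE) (h)` with `h` supplied BY NAME from the
leaf `RelativeIharaCokernelOfCurve 3 3 1` (its body is p3's `h` definitionally). In the C3 skeleton this reads
`maninPrimeToThreeAtNine_of_katoShift_of_reducible (katoShiftTwistManinThree_of_shiftStep_of_relativeIharaCokernelOfCurve331
(stub_three_dvd_shiftClass stub_katoFactThreePolar) stub_relativeIharaCokernel331) stub_reducible_residual` with
`stub_relativeIharaCokernel331 : RelativeIharaCokernelOfCurve 3 3 1`. [folklore] -/
theorem katoShiftTwistManinThree_of_shiftStep_of_relativeIharaCokernelOfCurve331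
    (hE : ∀ (W : WeierstrassCurve ℚ) [W.IsElliptic] [W.IsGloballyMinimal] {N : ℕ} [NeZero N]
      (D : ModularParametrizationData W N),
      (∀ z ∈ D.L.lattice, ∃ w ∈ periodLattice D.f, z = D.c * w) → 3 ^ 2 ∣ N →
      ¬ W.HasGoodReductionAtPrime 3 → ¬ W.HasMultiplicativeReductionAtPrime 3 →
      W.HasIrreducibleModPGaloisRep 3 → (3 : ℤ) ∣ D.c →
      ∀ ℓ : ℕ, AdmissiblePrime W N ℓ → ∀ a : ℕ, 0 < a → a < ℓ →
        ∃ n : ℤ, (shiftClass D.f ℓ a).im = 3 * n * (minusPeriod D.f / 2))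
    (hH : RelativeIharaCokernelOfCurve 3 3 1) :
    KatoShiftTwistManinThree :=
  katoShiftTwistManinThree_of_shiftStep_of_relativeIharaCokernelOfCurve hE hH

end Summit.BirchSwinnertonDyer.BirchSwinnertonDyer.Theorems.ManinLocalTwoThree

end
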